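import Mathlib
import HarnessLib
import Literature.MathematicalPhysics.QuantumLattice.KohnLuttinger
import Literature.MathematicalPhysics.QuantumLattice.KohnLuttingerLindhardMeasurable
import Literature.Computability.MetaComplexity.TaylorCosineMinorants
import Summits.HubbardSuperconductivity.HubbardSuperconductivity.Theorems.ChiralWindowCwKLChiralWindowMuWindow

/-!
# Route `KLProgramme` — support item `MuOfDopingWindow` (stmt-HubbardSuperconductivity-19939):
# the certified upper filling bound `n(-1) < 13/20`

For the nearest-neighbour band `ε₀ = squareDispersion 1 0` (`ε₀ p = -2 (cos p₀ + cos p₁)`) the filling is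
`n(μ) = 2 vol({ε₀ < μ} ∩ BZ) / (2π)²` (`kl_mu_filling_eq`).  The lower end `-1` of the analysis window of
item `MuOfDopingWindow` needs `n(-1) < 13/20` (true value `0.6166`; the tree's disc bound
`stub_klFillingUpper` only gives `n(-1) ≤ 7/10`).  We follow the octagon method of
`ChiralWindowCwChiralConstructionFillingBelowSevenTenths.lean` for the Fermi sea
`{cos p₀ + cos p₁ > 1/2, pᵢ ∈ [-π, π)}`:

* `|pᵢ| < 21/10`: `cos pᵢ > 1/2 - 1 = -1/2 ≥ cos (21/10)` (degree-`8` Taylor majorant of `cos`);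
* `|p₀| + |p₁| < 1319/500`: by `cos a + cos b = 2 cos ((a+b)/2) cos ((a-b)/2)` and
  `cos (1319/1000) ≤ 1/4`.

The octagon `{|x|, |y| < 21/10, |x| + |y| < 1319/500}` is covered by the box
`(-269/500, 269/500) × (-21/10, 21/10)` and two trapezoids, total area `1595039/125000 = 12.7603 < 1.3 π²`
(`π > 3.1415`), which is the threshold for `n < 13/20`.  Hence `muWinU_filling_lt : n(-1) < 13/20`.
Folklore; no definitions.
-/

noncomputable section

set_option linter.dupNamespace false

namespace Summit.HubbardSuperconductivity.HubbardSuperconductivity.Theorems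

open MeasureTheory Set Literature.MathematicalPhysics.QuantumLattice

/-! ### Certified cosines -/

/-- The degree-`8` Taylor majorant of the cosine, valid on all of `ℝ` (the tree's `cos_le_cosTaylorSum` at
`M = 4`). [folklore] -/
theorem cos_le_taylor_eight_real (y : ℝ) :
    Real.cos y ≤ 1 - y ^ 2 / 2 + y ^ 4 / 24 - y ^ 6 / 720 + y ^ 8 / 40320 := by
  have h := Literature.Computability.MetaComplexity.cos_le_cosTaylorSum (M := 4) (by decide) y
  simp only [Finset.sum_range_succ, Finset.sum_range_zero] at h
  norm_num [Nat.factorial] at h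
  linarith

/-- `cos (21/10) ≤ -1/2` (`cos 2.1 = -0.5048…`). [folklore] -/
theorem muWinU_cos_le_neg_half : Real.cos (21 / 10) ≤ -1 / 2 := by
  have h := cos_le_taylor_eight_real (21 / 10 : ℝ)
  norm_num at h
  linarith

/-- `cos (1319/1000) ≤ 1/4` (`cos 1.319 = 0.2491…`). [folklore] -/
theorem muWinU_cos_le_quarter : Real.cos (1319 / 1000) ≤ 1 / 4 := by
  have h := cos_le_taylor_eight_real (1319 / 1000 : ℝ)
  norm_num at h
  linarith

/-! ### The planar inequalities -/

/-- If `|x| ≤ π` and `cos x > -1/2` then `|x| < 21/10`. [folklore] -/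
theorem muWinU_abs_lt {x : ℝ} (hx : |x| ≤ Real.pi) (hc : -1 / 2 < Real.cos x) : |x| < 21 / 10 := by
  rcases lt_or_ge |x| (21 / 10) with h | h
  · exact h
  · exfalso
    have := Real.cos_le_cos_of_nonneg_of_le_pi (by norm_num) hx h
    rw [Real.cos_abs] at this
    linarith [muWinU_cos_le_neg_half]

/-- For `a, b ∈ [0, π]` with `cos a + cos b > 1/2` one has `a + b < 1319/500`. [folklore] -/
theorem muWinU_add_lt {a b : ℝ} (ha0 : 0 ≤ a) (haπ : a ≤ Real.pi) (hb0 : 0 ≤ b) (hbπ : b ≤ Real.pi)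
    (h : 1 / 2 < Real.cos a + Real.cos b) : a + b < 1319 / 500 := by
  rcases lt_or_ge (a + b) (1319 / 500) with hD | hD
  · exact hD
  · exfalso
    rw [Real.cos_add_cos] at h
    have hu : Real.cos ((a + b) / 2) ≤ 1 / 4 :=
      (Real.cos_le_cos_of_nonneg_of_le_pi (by norm_num) (by linarith) (by linarith)).trans
        muWinU_cos_le_quarter
    have hv0 : 0 ≤ Real.cos ((a - b) / 2) :=
      Real.cos_nonneg_of_mem_Icc ⟨by linarith [Real.pi_pos], by linarith [Real.pi_pos]⟩
    have hv1 := Real.cos_le_one ((a - b) / 2)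
    nlinarith [mul_nonneg (sub_nonneg.2 hu) hv0]

/-- Octagon containment of the Fermi sea at energy `-1`, in coordinates: an occupied momentum `p` of the
Brillouin zone has `|p₀| < 21/10`, `|p₁| < 21/10` and `|p₀| + |p₁| < 1319/500`. [folklore] -/
theorem muWinU_occupied_coords {p : Momentum}
    (hp : p ∈ {p : Momentum | squareDispersion 1 0 p < -(1 : ℝ)} ∩ brillouinZone) :
    |p 0| < 21 / 10 ∧ |p 1| < 21 / 10 ∧ |p 0| + |p 1| < 1319 / 500 := by
  obtain ⟨hp1, hp2⟩ := hp
  simp only [mem_setOf_eq, squareDispersion] at hp1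
  have hsum : 1 / 2 < Real.cos (p 0) + Real.cos (p 1) := by linarith
  have habs : ∀ i, |p i| ≤ Real.pi := fun i => by
    have := hp2 i
    rw [abs_le]
    exact ⟨this.1, this.2.le⟩
  refine ⟨muWinU_abs_lt (habs 0) (by linarith [Real.cos_le_one (p 1)]),
    muWinU_abs_lt (habs 1) (by linarith [Real.cos_le_one (p 0)]), ?_⟩
  rw [← Real.cos_abs (p 0), ← Real.cos_abs (p 1)] at hsum
  exact muWinU_add_lt (abs_nonneg _) (habs 0) (abs_nonneg _) (habs 1) hsum

/-! ### The octagon: three pieces in `ℝ × ℝ` and their areas -/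

/-- The Fermi sea at energy `-1`, read in the coordinates `(p₀, p₁)`, lies in the union of the box
`(-269/500, 269/500) × (-21/10, 21/10)` and the two trapezoids `{269/500 ≤ x ≤ 21/10, |y| < 1319/500 - x}`,
`{-21/10 ≤ x ≤ -269/500, |y| < 1319/500 + x}`. [folklore] -/
theorem muWinU_occupied_subset_preimage :
    {p : Momentum | squareDispersion 1 0 p < -(1 : ℝ)} ∩ brillouinZone ⊆
      (fun k : Momentum => ((k 0, k 1) : ℝ × ℝ)) ⁻¹'
        ((Ioo (-(269 / 500 : ℝ)) (269 / 500) ×ˢ Ioo (-(21 / 10 : ℝ)) (21 / 10)) ∪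
          regionBetween (fun x : ℝ => x - 1319 / 500) (fun x => 1319 / 500 - x)
            (Icc (269 / 500) (21 / 10)) ∪
          regionBetween (fun x : ℝ => -x - 1319 / 500) (fun x => x + 1319 / 500)
            (Icc (-(21 / 10)) (-(269 / 500)))) := by
  intro p hp
  obtain ⟨h0, h1, hs⟩ := muWinU_occupied_coords hp
  rw [abs_lt] at h0 h1
  simp only [mem_preimage, mem_union, mem_prod, mem_Ioo, regionBetween, mem_setOf_eq, mem_Icc]
  rcases le_or_gt (p 0) (-(269 / 500)) with hlo | hlo
  · -- left trapezoid
    right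
    rw [abs_of_neg (by linarith)] at hs
    have := abs_lt.1 (show |p 1| < 1319 / 500 + p 0 by linarith)
    exact ⟨⟨by linarith, by linarith⟩, by linarith, by linarith⟩
  rcases le_or_gt (269 / 500) (p 0) with hhi | hhi
  · -- right trapezoid
    left; right
    rw [abs_of_pos (by linarith)] at hs
    have := abs_lt.1 (show |p 1| < 1319 / 500 - p 0 by linarith)
    exact ⟨⟨by linarith, by linarith⟩, by linarith, by linarith⟩
  · -- central box
    left; left
    exact ⟨⟨by linarith, by linarith⟩, by linarith, by linarith⟩

/-- The union of the three pieces is measurable. [folklore] -/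
theorem muWinU_measurableSet_pieces :
    MeasurableSet
      ((Ioo (-(269 / 500 : ℝ)) (269 / 500) ×ˢ Ioo (-(21 / 10 : ℝ)) (21 / 10)) ∪
        regionBetween (fun x : ℝ => x - 1319 / 500) (fun x => 1319 / 500 - x)
          (Icc (269 / 500) (21 / 10)) ∪
        regionBetween (fun x : ℝ => -x - 1319 / 500) (fun x => x + 1319 / 500)
          (Icc (-(21 / 10)) (-(269 / 500)))) := by
  refine ((measurableSet_Ioo.prod measurableSet_Ioo).union ?_).union ?_
  · exact measurableSet_regionBetween (by fun_prop) (by fun_prop) measurableSet_Icc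
  · exact measurableSet_regionBetween (by fun_prop) (by fun_prop) measurableSet_Icc

/-- Area of the central box: `(538/500) · (42/10) = 5649/1250`. [folklore] -/
theorem muWinU_volume_box :
    volume (Ioo (-(269 / 500 : ℝ)) (269 / 500) ×ˢ Ioo (-(21 / 10 : ℝ)) (21 / 10)) =
      ENNReal.ofReal (5649 / 1250) := by
  rw [Measure.volume_eq_prod, Measure.prod_prod, Real.volume_Ioo, Real.volume_Ioo,
    ← ENNReal.ofReal_mul (by norm_num)]
  congr 1
  norm_num

/-- `∫_{269/500}^{21/10} (1319/250 - 2x) dx = 1030139/250000`. [folklore] -/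
theorem muWinU_integral_right :
    ∫ x in (269 / 500 : ℝ)..(21 / 10), ((1319 / 250 : ℝ) - 2 * x) = 1030139 / 250000 := by
  rw [intervalIntegral.integral_sub intervalIntegrable_const
      (Continuous.intervalIntegrable (by fun_prop) _ _),
    intervalIntegral.integral_const, intervalIntegral.integral_const_mul, integral_id]
  norm_num

/-- `∫_{-21/10}^{-269/500} (1319/250 + 2x) dx = 1030139/250000`. [folklore] -/
theorem muWinU_integral_left :
    ∫ x in (-(21 / 10) : ℝ)..(-(269 / 500)), ((1319 / 250 : ℝ) + 2 * x) = 1030139 / 250000 := by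
  rw [intervalIntegral.integral_add intervalIntegrable_const
      (Continuous.intervalIntegrable (by fun_prop) _ _),
    intervalIntegral.integral_const, intervalIntegral.integral_const_mul, integral_id]
  norm_num

/-- Area of the right trapezoid `{269/500 ≤ x ≤ 21/10, |y| < 1319/500 - x}`: `1030139/250000`.
[folklore] -/
theorem muWinU_volume_right :
    volume (regionBetween (fun x : ℝ => x - 1319 / 500) (fun x => 1319 / 500 - x)
      (Icc (269 / 500) (21 / 10))) = ENNReal.ofReal (1030139 / 250000) := by
  rw [Measure.volume_eq_prod, volume_regionBetween_eq_integral
    (Continuous.integrableOn_Icc (by fun_prop)) (Continuous.integrableOn_Icc (by fun_prop))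
    measurableSet_Icc (fun x hx => by simp only [mem_Icc] at hx; linarith)]
  congr 1
  have hfun : ((fun x : ℝ => 1319 / 500 - x) - fun x : ℝ => x - 1319 / 500) =
      fun x => (1319 / 250 : ℝ) - 2 * x := by
    funext x
    simp only [Pi.sub_apply]
    ring
  rw [hfun, integral_Icc_eq_integral_Ioc, ← intervalIntegral.integral_of_le (by norm_num),
    muWinU_integral_right]

/-- Area of the left trapezoid `{-21/10 ≤ x ≤ -269/500, |y| < 1319/500 + x}`: `1030139/250000`.
[folklore] -/
theorem muWinU_volume_left :
    volume (regionBetween (fun x : ℝ => -x - 1319 / 500) (fun x => x + 1319 / 500)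
      (Icc (-(21 / 10)) (-(269 / 500)))) = ENNReal.ofReal (1030139 / 250000) := by
  rw [Measure.volume_eq_prod, volume_regionBetween_eq_integral
    (Continuous.integrableOn_Icc (by fun_prop)) (Continuous.integrableOn_Icc (by fun_prop))
    measurableSet_Icc (fun x hx => by simp only [mem_Icc] at hx; linarith)]
  congr 1
  have hfun : ((fun x : ℝ => x + 1319 / 500) - fun x : ℝ => -x - 1319 / 500) =
      fun x => (1319 / 250 : ℝ) + 2 * x := by
    funext x
    simp only [Pi.sub_apply]
    ring
  rw [hfun, integral_Icc_eq_integral_Ioc, ← intervalIntegral.integral_of_le (by norm_num),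
    muWinU_integral_left]

/-- Total area of the three pieces: at most `5649/1250 + 2 · 1030139/250000 = 1595039/125000`.
[folklore] -/
theorem muWinU_volume_pieces_le :
    volume
      ((Ioo (-(269 / 500 : ℝ)) (269 / 500) ×ˢ Ioo (-(21 / 10 : ℝ)) (21 / 10)) ∪
        regionBetween (fun x : ℝ => x - 1319 / 500) (fun x => 1319 / 500 - x)
          (Icc (269 / 500) (21 / 10)) ∪
        regionBetween (fun x : ℝ => -x - 1319 / 500) (fun x => x + 1319 / 500)
          (Icc (-(21 / 10)) (-(269 / 500)))) ≤ ENNReal.ofReal (1595039 / 125000) := by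
  refine (measure_union_le _ _).trans ?_
  refine (add_le_add (measure_union_le _ _) le_rfl).trans ?_
  rw [muWinU_volume_box, muWinU_volume_right, muWinU_volume_left,
    ← ENNReal.ofReal_add (by norm_num) (by norm_num), ← ENNReal.ofReal_add (by norm_num) (by norm_num)]
  exact ENNReal.ofReal_le_ofReal (by norm_num)

/-! ### Transport to momentum space and the filling bound -/

/-- The occupied volume at energy `-1` is at most the octagon area `1595039/125000 = 12.7603` (transport
by the volume-preserving coordinate map `k ↦ (k₀, k₁)`). [folklore] -/
theorem muWinU_volume_occupied_le :
    (volume ({p : Momentum | squareDispersion 1 0 p < -(1 : ℝ)} ∩ brillouinZone)).toReal ≤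
      1595039 / 125000 := by
  refine ENNReal.toReal_le_of_le_ofReal (by norm_num) ?_
  refine (measure_mono muWinU_occupied_subset_preimage).trans ?_
  rw [measurePreserving_momentum_prod.measure_preimage muWinU_measurableSet_pieces.nullMeasurableSet]
  exact muWinU_volume_pieces_le

/-- **Certified upper filling bound at the lower end of the analysis window**: `n(-1) < 13/20`
(`vol ≤ 12.7603 < 1.3 π²`, `π > 3.1415`; true value `n(-1) = 0.6166`). [folklore] -/
theorem muWinU_filling_lt :
    KohnLuttinger.filling (squareDispersion 1 0) (-(1 : ℝ)) < 13 / 20 := by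
  rw [kl_mu_filling_eq]
  have hV := muWinU_volume_occupied_le
  have hpi := Real.pi_gt_d4
  have hpi2 : (3.1415 : ℝ) * 3.1415 < Real.pi * Real.pi :=
    mul_self_lt_mul_self (by norm_num) hpi
  rw [div_lt_iff₀ (by positivity)]
  nlinarith

end Summit.HubbardSuperconductivity.HubbardSuperconductivity.Theorems

end
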